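import Summits.HodgeConjecture.HodgeCM.PerL34.ArchBall_1

/-! PORT of `HodgeCM/PerL34/ArchBall.lean` (HodgeCMPerL run 82) — part 2: continuation of `Summits.HodgeConjecture.HodgeCM.PerL34.ArchBall_1` (split at a top-level declaration boundary by port_pkg.py; scope re-opened below; declarations unchanged). -/

-- port_pkg: scope re-opened for this part (file-level context, then the namespace/section stack open at the cut)
set_option autoImplicit false
noncomputable section
open scoped Matrix
open NumberField
namespace HodgeCM.PerL34.ArchCompactK
section PerLBall
open HodgeCM.PerL34.AdelicUnitaryFactorisation HodgeCM.Literature.RealApproximation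
open Literature.AlgebraicGeometry.ShimuraVarieties (signatureMatrix)
open HodgeCM.PerL34.BallModel (U21 GL3 Ball x₀ mat mkU21 mat_mkU21 J)
open NumberField
variable {L : CMField} {ι₁ : L →+* ℂ} (V : HermSpace3 L ι₁) {T : GL (Fin 3) ℂ}
  (hT : (T : Matrix (Fin 3) (Fin 3) ℂ)ᴴ * V.Hm.map (InfinitePlace.mk ι₁).embedding *
    (T : Matrix (Fin 3) (Fin 3) ℂ) = signatureMatrix 2)
include hT
/-- `[g] ↦ [T⁻¹ g_{w₁} T]`. -/
def _root_.HodgeCM.HermSpace3.quotientArchKToQuotient :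
    Uinf L V.Hm ⧸ V.archK T → U21 ⧸ MulAction.stabilizer U21 x₀ :=
  Quotient.map' (V.archToU21 hT) fun a b hab => QuotientGroup.leftRel_apply.mpr (by
    rw [← map_inv, ← map_mul, archToU21_mem_stabilizer_iff]
    exact QuotientGroup.leftRel_apply.mp hab)

/-- (Ported verbatim from the HodgeCMPerL package; no docstring in the source.) -/
@[simp] theorem quotientArchKToQuotient_mk (g : Uinf L V.Hm) :
    V.quotientArchKToQuotient hT (QuotientGroup.mk g) = QuotientGroup.mk (V.archToU21 hT g) := rfl

/-- (Ported verbatim from the HodgeCMPerL package; no docstring in the source.) -/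
theorem continuous_quotientArchKToQuotient : Continuous (V.quotientArchKToQuotient hT) :=
  (continuous_archToU21 V hT).quotient_map' _

/-- `[m] ↦ [archOfU21 m]`. -/
def _root_.HodgeCM.HermSpace3.quotientToQuotientArchK :
    U21 ⧸ MulAction.stabilizer U21 x₀ → Uinf L V.Hm ⧸ V.archK T :=
  Quotient.map' (V.archOfU21 hT) fun a b hab => QuotientGroup.leftRel_apply.mpr (by
    rw [← map_inv, ← map_mul, ← archToU21_mem_stabilizer_iff V hT, archToU21_archOfU21]
    exact QuotientGroup.leftRel_apply.mp hab)

/-- (Ported verbatim from the HodgeCMPerL package; no docstring in the source.) -/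
@[simp] theorem quotientToQuotientArchK_mk (m : U21) :
    V.quotientToQuotientArchK hT (QuotientGroup.mk m) = QuotientGroup.mk (V.archOfU21 hT m) := rfl

/-- (Ported verbatim from the HodgeCMPerL package; no docstring in the source.) -/
theorem continuous_quotientToQuotientArchK : Continuous (V.quotientToQuotientArchK hT) :=
  (continuous_archOfU21 V hT).quotient_map' _

/-- (Ported verbatim from the HodgeCMPerL package; no docstring in the source.) -/
theorem quotientArchKToQuotient_quotientToQuotientArchK (q : U21 ⧸ MulAction.stabilizer U21 x₀) :
    V.quotientArchKToQuotient hT (V.quotientToQuotientArchK hT q) = q := by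
  induction q using QuotientGroup.induction_on with
  | H m => rw [quotientToQuotientArchK_mk, quotientArchKToQuotient_mk, archToU21_archOfU21]

/-- (Ported verbatim from the HodgeCMPerL package; no docstring in the source.) -/
theorem quotientToQuotientArchK_quotientArchKToQuotient (q : Uinf L V.Hm ⧸ V.archK T) :
    V.quotientToQuotientArchK hT (V.quotientArchKToQuotient hT q) = q := by
  induction q using QuotientGroup.induction_on with
  | H g =>
    rw [quotientArchKToQuotient_mk, quotientToQuotientArchK_mk]
    refine QuotientGroup.eq.mpr ?_
    rw [← archToU21_mem_stabilizer_iff V hT, map_mul, map_inv, archToU21_archOfU21, inv_mul_cancel]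
    exact one_mem _

/-- **`G_U(ℝ)/K_∞ ≃ₜ U(2,1)/(U(2) × U(1))`.** -/
def _root_.HodgeCM.HermSpace3.quotientArchKHomeomorph :
    Uinf L V.Hm ⧸ V.archK T ≃ₜ U21 ⧸ MulAction.stabilizer U21 x₀ where
  toFun := V.quotientArchKToQuotient hT
  invFun := V.quotientToQuotientArchK hT
  left_inv := quotientToQuotientArchK_quotientArchKToQuotient V hT
  right_inv := quotientArchKToQuotient_quotientToQuotientArchK V hT
  continuous_toFun := continuous_quotientArchKToQuotient V hT
  continuous_invFun := continuous_quotientToQuotientArchK V hT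

/-- **`G_U(ℝ)/K_∞ ≃ₜ 𝔹²`** (PerL v5 l. 66), `[g] ↦ (T⁻¹ g_{w₁} T) • x₀`. -/
def _root_.HodgeCM.HermSpace3.quotientArchKHomeomorphBall : Uinf L V.Hm ⧸ V.archK T ≃ₜ Ball :=
  (V.quotientArchKHomeomorph hT).trans BallStabilizer.quotientStabilizerHomeomorphBall

/-- (Ported verbatim from the HodgeCMPerL package; no docstring in the source.) -/
@[simp] theorem quotientArchKHomeomorphBall_apply_mk (g : Uinf L V.Hm) :
    V.quotientArchKHomeomorphBall hT (QuotientGroup.mk g) = V.archToU21 hT g • x₀ := rfl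

/-- **Equivariance**: `G_U(ℝ)` acts on `𝔹²` through `archToU21`, compatibly with its action on `G_U(ℝ)/K_∞`. -/
theorem quotientArchKHomeomorphBall_smul (γ : Uinf L V.Hm) (q : Uinf L V.Hm ⧸ V.archK T) :
    V.quotientArchKHomeomorphBall hT (γ • q) = V.archToU21 hT γ • V.quotientArchKHomeomorphBall hT q := by
  induction q using QuotientGroup.induction_on with
  | H g => rw [MulAction.Quotient.smul_mk, smul_eq_mul, quotientArchKHomeomorphBall_apply_mk,
      quotientArchKHomeomorphBall_apply_mk, map_mul, mul_smul]

/-- The orbit map `G_U(ℝ) → 𝔹²`, `g ↦ (T⁻¹ g_{w₁} T) • x₀`, is continuous, surjective and PROPER, with fibres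
the cosets of `K_∞`. -/
theorem isProperMap_archOrbit : IsProperMap fun g : Uinf L V.Hm => V.archToU21 hT g • x₀ := by
  have : (fun g : Uinf L V.Hm => V.archToU21 hT g • x₀) =
      V.quotientArchKHomeomorphBall hT ∘ (QuotientGroup.mk : Uinf L V.Hm → Uinf L V.Hm ⧸ V.archK T) :=
    funext fun g => (quotientArchKHomeomorphBall_apply_mk V hT g).symm
  rw [this]
  exact (V.quotientArchKHomeomorphBall hT).isProperMap.comp (isProperMap_mk _ (V.isCompact_archK T))

/-- (Ported verbatim from the HodgeCMPerL package; no docstring in the source.) -/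
theorem surjective_archOrbit : Function.Surjective fun g : Uinf L V.Hm => V.archToU21 hT g • x₀ := fun z =>
  ⟨V.archOfU21 hT (BallFrame.sec z), by simp only [archToU21_archOfU21, BallFrame.sec_smul_x₀]⟩

/-- **The pieces of `S(K_f)` on the ball**: for every `Γ ≤ G_U(ℝ)`,
`Γ \ (G_U(ℝ)/K_∞) ≃ₜ Γ' \ 𝔹²` with `Γ' = archToU21 (Γ) ≤ U(2,1)` (PerL v5 l. 70: `S(K_f) = ⨆ Γ \ 𝔹²`). -/
def _root_.HodgeCM.HermSpace3.pieceHomeomorphBall (Γ : Subgroup (Uinf L V.Hm)) :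
    Quotient (MulAction.orbitRel Γ (Uinf L V.Hm ⧸ V.archK T)) ≃ₜ
      Quotient (MulAction.orbitRel (Γ.map (V.archToU21 hT)) Ball) :=
  orbitQuotientHomeomorph (V.archToU21 hT) (V.quotientArchKHomeomorphBall hT) (quotientArchKHomeomorphBall_smul V hT) Γ

end PerLBall

end HodgeCM.PerL34.ArchCompactK

end

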